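import Summits.HodgeConjecture.HodgeConjecture.Theses.MumfordCurveRigidFibreCount
import Literature.AlgebraicGeometry.HodgeTheory.AlgebraicityLocusStrata
import Literature.AlgebraicGeometry.HodgeTheory.AlgebraicityLocusCurves
import Literature.AlgebraicGeometry.HodgeTheory.CurvePoleSpaces
import Literature.AlgebraicGeometry.Motives.VarietiesGeometricallyIntegralProofs
import Literature.AlgebraicGeometry.Motives.VarietiesProperProofs
import Literature.AlgebraicGeometry.Motives.VarietiesQuasiCompactProofs

/-!
# First rung of `InfiniteAnchorSaturation` (route MumfordCurveRigidFibreCount): uncountably many anchors saturate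

Support theorems (sorry-free) for the crux
`Summit.HodgeConjecture.HodgeConjecture.Theses.MumfordCurveRigidFibreCount.InfiniteAnchorSaturation`
(item stmt-HodgeConjecture-20123), landing the BC5 witness of the route's birth certificate:

* `mumfordCurve_curveStrataDichotomy` — a Zariski-closed-on-points subset of the complex points of a smooth projective
  curve is FINITE OR EVERYTHING (Noetherian decomposition; closed points of a smooth curve are
  specialisation-maximal below the generic point);
* `mumfordCurve_uncountableAnchorSaturation_of` — granted the named Literature fact
  `charlesSchnell_algebraicityLocus_iUnion_closed` (Charles–Schnell 2014, Prop. 11.3.11: the algebraicity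
  locus is a countable increasing union of Zariski-closed strata), a degree-4 class on a smooth projective
  family of 8-folds over a smooth projective curve that is algebraic at UNCOUNTABLY many fibres is algebraic at
  EVERY fibre: some stratum is uncountable, hence infinite, hence all of `V(ℂ)` — the 0–∞ law behind the crux;
* `stub_uncountableAnchorSaturation` — the registered stub of the line `Lines/birth.lean` with this exact
  signature, closed here by name;
* `mumfordCurve_infiniteAnchorSaturation_of_uncountableLocus` — consequently the crux follows from the fact together with
  the counting statement "infinitely many algebraic fibres ⇒ uncountably many" (the registered open stub
  `stub_uncountableLocus` of the line `Lines/birth.lean`), stated here with explicit binders.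

The crux itself is NOT proved here (HC-strength on the Mumford sector); these are its proved lower rungs.
-/

open CategoryTheory AlgebraicGeometry Topology

namespace Summit.HodgeConjecture.HodgeConjecture.Theorems

open Literature.AlgebraicGeometry.Motives Literature.AlgebraicGeometry.HodgeTheory in
/-- A closed subset of a smooth projective curve missing the generic point is finite (Noetherian
decomposition into irreducible closed pieces, each the closure of a non-generic, hence closed, point). -/
theorem mumfordCurve_finite_of_isClosed_of_genericPoint_not_mem {V : SchemeOver ℂ} [IsIntegral V.left]
    [SmoothOfRelativeDimension 1 V.hom] (hV : IsSmoothProjective 1 V)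
    {C : Set V.left} (hC : IsClosed C) (htop : genericPoint V.left ∉ C) : C.Finite := by
  haveI : LocallyOfFiniteType V.hom := locallyOfFiniteType_of_smoothCurve V
  haveI : IsLocallyNoetherian V.left := LocallyOfFiniteType.isLocallyNoetherian V.hom
  haveI : CompactSpace V.left := IsSmoothProjective.compactSpace_holds hV
  haveI : IsNoetherian V.left := {}
  obtain ⟨S, hSfin, hScl, hSirr, hCeq⟩ :=
    TopologicalSpace.NoetherianSpace.exists_finite_set_isClosed_irreducible hC
  rw [hCeq]
  refine hSfin.sUnion fun t ht => ?_
  obtain ⟨x, hx⟩ := QuasiSober.sober (hSirr t ht) (hScl t ht)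
  have hxt : x ∈ t := hx.mem
  have hxne : x ≠ (⊤ : V.left) := by
    intro hxe
    apply htop
    rw [hCeq]
    have hgt : genericPoint V.left ∈ t := by
      have h' : (⊤ : V.left) ∈ t := hxe ▸ hxt
      exact h'
    exact Set.mem_sUnion_of_mem hgt ht
  refine (Set.finite_singleton x).subset fun y hy => ?_
  exact eq_of_specializes_of_ne_top hxne (hx.specializes hy)

open Literature.AlgebraicGeometry.Motives Literature.AlgebraicGeometry.HodgeTheory in
/-- **Curve strata dichotomy** (G2a of the sketch mumford-curve-rigid-fibre-count): a set of complex
points of a smooth projective curve which is Zariski-closed on points and infinite is everything. -/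
theorem mumfordCurve_curveStrataDichotomy (V : SchemeOver ℂ) (hV : IsSmoothProjective 1 V)
    (Z : Set (ComplexPoints V)) (hZ : IsZariskiClosedOnPoints V Z) (hinf : Z.Infinite) :
    Z = Set.univ := by
  haveI := hV.smoothOfRelativeDimension
  haveI : IsIntegral V.left := IsSmoothProjective.isIntegral_holds hV
  obtain ⟨C, hC, rfl⟩ := hZ
  by_cases htop : genericPoint V.left ∈ C
  · ext P
    simp only [Set.mem_setOf_eq, Set.mem_univ, iff_true]
    have hP : P.pt ∈ closure ({genericPoint V.left} : Set V.left) := by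
      rw [(genericPoint_spec V.left).def]; trivial
    exact hC.closure_subset_iff.2 (Set.singleton_subset_iff.2 htop) hP
  · exfalso
    apply hinf
    have hCfin : C.Finite := mumfordCurve_finite_of_isClosed_of_genericPoint_not_mem hV hC htop
    exact hCfin.preimage (pt_injective V).injOn

/-! ### BC5 rung, proved from the named fact: uncountably many anchors saturate -/

/-- **First rung of the crux** (BC5): granted the Charles–Schnell strata fact, a class algebraic at
UNCOUNTABLY many fibres of a smooth projective family over a smooth projective curve is algebraic at
every fibre — some closed stratum of the algebraicity locus is infinite, hence (dichotomy) everything. -/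
theorem mumfordCurve_uncountableAnchorSaturation_of
    (h₁ : Literature.AlgebraicGeometry.HodgeTheory.charlesSchnell_algebraicityLocus_iUnion_closed)
    (V 𝒜 : Literature.AlgebraicGeometry.Motives.SchemeOver ℂ) (f : 𝒜 ⟶ V)
    (hV : Literature.AlgebraicGeometry.Motives.IsSmoothProjective 1 V)
    (hf : Literature.AlgebraicGeometry.Motives.IsSmoothProjectiveFamily f 8)
    (h𝒜 : Literature.AlgebraicGeometry.HodgeTheory.IsQuasiProjectiveOver 𝒜)
    (δ : Literature.AlgebraicGeometry.HodgeTheory.complexBetti 𝒜 (2 * 2))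
    (hunc : ¬ {s : Literature.AlgebraicGeometry.Motives.ComplexPoints V |
      Literature.AlgebraicGeometry.HodgeTheory.complexBetti.map
        (Literature.AlgebraicGeometry.Motives.fiberι f s) (2 * 2) δ ∈
        Literature.AlgebraicGeometry.HodgeTheory.algebraicClasses
          (Literature.AlgebraicGeometry.Motives.fiberOver f s) 2}.Countable)
    (t : Literature.AlgebraicGeometry.Motives.ComplexPoints V) :
    Literature.AlgebraicGeometry.HodgeTheory.complexBetti.map
        (Literature.AlgebraicGeometry.Motives.fiberι f t) (2 * 2) δ ∈
      Literature.AlgebraicGeometry.HodgeTheory.algebraicClasses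
        (Literature.AlgebraicGeometry.Motives.fiberOver f t) 2 := by
  haveI := hV.smoothOfRelativeDimension
  have hSsm : AlgebraicGeometry.Smooth V.hom := AlgebraicGeometry.SmoothOfRelativeDimension.smooth 1 V.hom
  obtain ⟨T, -, hTclosed, hlocus⟩ :=
    Literature.AlgebraicGeometry.HodgeTheory.charlesSchnell_algebraicityLocus_iUnion_closed.exists_monotone_strata
      h₁ f h𝒜 (Literature.AlgebraicGeometry.HodgeTheory.IsQuasiProjectiveOver.of_isProjectiveOver
        hV.isProjectiveOver) hSsm hf 2 δ
  have hd : ∃ d, (T d).Infinite := by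
    by_contra hcon
    push Not at hcon
    apply hunc
    rw [hlocus]
    exact Set.countable_iUnion fun d => (hcon d).countable
  obtain ⟨d, hd⟩ := hd
  have huniv : T d = Set.univ := mumfordCurve_curveStrataDichotomy V hV (T d) (hTclosed d) hd
  have ht : t ∈ ⋃ d, T d := Set.mem_iUnion.2 ⟨d, huniv ▸ Set.mem_univ t⟩
  rw [← hlocus] at ht
  exact ht


/-- **The crux from the fact and the counting statement.** If, for the given family and class, infinitely
many algebraic fibres force uncountably many, then (granted the Charles–Schnell fact) the conclusion of
`InfiniteAnchorSaturation` holds for that family and class. -/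
theorem mumfordCurve_infiniteAnchorSaturation_of_uncountableLocus
    (h₁ : Literature.AlgebraicGeometry.HodgeTheory.charlesSchnell_algebraicityLocus_iUnion_closed)
    (V 𝒜 : Literature.AlgebraicGeometry.Motives.SchemeOver ℂ) (f : 𝒜 ⟶ V)
    (hV : Literature.AlgebraicGeometry.Motives.IsSmoothProjective 1 V)
    (hf : Literature.AlgebraicGeometry.Motives.IsSmoothProjectiveFamily f 8)
    (h𝒜 : Literature.AlgebraicGeometry.HodgeTheory.IsQuasiProjectiveOver 𝒜)
    (δ : Literature.AlgebraicGeometry.HodgeTheory.complexBetti 𝒜 (2 * 2))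
    (hcount : {s : Literature.AlgebraicGeometry.Motives.ComplexPoints V |
      Literature.AlgebraicGeometry.HodgeTheory.complexBetti.map
        (Literature.AlgebraicGeometry.Motives.fiberι f s) (2 * 2) δ ∈
        Literature.AlgebraicGeometry.HodgeTheory.algebraicClasses
          (Literature.AlgebraicGeometry.Motives.fiberOver f s) 2}.Infinite →
      ¬ {s : Literature.AlgebraicGeometry.Motives.ComplexPoints V |
      Literature.AlgebraicGeometry.HodgeTheory.complexBetti.map
        (Literature.AlgebraicGeometry.Motives.fiberι f s) (2 * 2) δ ∈
        Literature.AlgebraicGeometry.HodgeTheory.algebraicClasses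
          (Literature.AlgebraicGeometry.Motives.fiberOver f s) 2}.Countable)
    (hinf : {s : Literature.AlgebraicGeometry.Motives.ComplexPoints V |
      Literature.AlgebraicGeometry.HodgeTheory.complexBetti.map
        (Literature.AlgebraicGeometry.Motives.fiberι f s) (2 * 2) δ ∈
        Literature.AlgebraicGeometry.HodgeTheory.algebraicClasses
          (Literature.AlgebraicGeometry.Motives.fiberOver f s) 2}.Infinite)
    (t : Literature.AlgebraicGeometry.Motives.ComplexPoints V) :
    Literature.AlgebraicGeometry.HodgeTheory.complexBetti.map
        (Literature.AlgebraicGeometry.Motives.fiberι f t) (2 * 2) δ ∈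
      Literature.AlgebraicGeometry.HodgeTheory.algebraicClasses
        (Literature.AlgebraicGeometry.Motives.fiberOver f t) 2 :=
  mumfordCurve_uncountableAnchorSaturation_of h₁ V 𝒜 f hV hf h𝒜 δ (hcount hinf) t

/-- **Registered stub `stub_uncountableAnchorSaturation` of crux item stmt-HodgeConjecture-20123, closed by
name and signature** (the BC5 rung of the route's birth certificate). -/
theorem stub_uncountableAnchorSaturation : Literature.AlgebraicGeometry.HodgeTheory.charlesSchnell_algebraicityLocus_iUnion_closed → ∀ (V 𝒜 : Literature.AlgebraicGeometry.Motives.SchemeOver ℂ) (f : 𝒜 ⟶ V), Literature.AlgebraicGeometry.Motives.IsSmoothProjective 1 V → Literature.AlgebraicGeometry.Motives.IsSmoothProjectiveFamily f 8 → Literature.AlgebraicGeometry.HodgeTheory.IsQuasiProjectiveOver 𝒜 → ∀ (δ : Literature.AlgebraicGeometry.HodgeTheory.complexBetti 𝒜 (2 * 2)), ¬ {s : Literature.AlgebraicGeometry.Motives.ComplexPoints V | Literature.AlgebraicGeometry.HodgeTheory.complexBetti.map (Literature.AlgebraicGeometry.Motives.fiberι f s) (2 * 2) δ ∈ Literature.AlgebraicGeometry.HodgeTheory.algebraicClasses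 (Literature.AlgebraicGeometry.Motives.fiberOver f s) 2}.Countable → ∀ t : Literature.AlgebraicGeometry.Motives.ComplexPoints V, Literature.AlgebraicGeometry.HodgeTheory.complexBetti.map (Literature.AlgebraicGeometry.Motives.fiberι f t) (2 * 2) δ ∈ Literature.AlgebraicGeometry.HodgeTheory.algebraicClasses (Literature.AlgebraicGeometry.Motives.fiberOver f t) 2 :=
  fun h₁ V 𝒜 f hV hf h𝒜 δ hunc t => mumfordCurve_uncountableAnchorSaturation_of h₁ V 𝒜 f hV hf h𝒜 δ hunc t

end Summit.HodgeConjecture.HodgeConjecture.Theorems
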